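import Literature.AnabelianGeometry.SemiGraphs.IncoherentBouquet
import HarnessLib

/-!
# Galois-countability is NOT hereditary along infinite tempered coverings of an incoherent base:
# an explicit countermodel (route T, T7d∞ — tightness of `CoveringGraphCoherent`)

Mochizuki, *Semi-graphs of anabelioids*, Publ. RIMS **42** (2006), §2 Def. 2.3 (iii) p. 25
(quasi-coherent; coherent = quasi-coherent with topologically finitely generated constituents), §3
Def. 3.5 (i)–(ii) p. 37 (the covering semi-graph of anabelioids `G_S → G` of `S ∈ B^cov(G)`,
`CovObj.coveringGraph`; tempered coverings), Rmk. 3.5.1 p. 37 (graph-coverings)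
[cite: MochizukiSemiAnbd2006, Def 3.5(i) p.37]; Galois-countability [IUTchI] Rmk. 2.5.3 (i) (T2) p. 52
[cite: Mochizuki2012, IUTchI Rmk 2.5.3 (i) (T2), p. 52].

abc-iut cell, layer L3, route T · T7d∞ (seat abc-iut-L3-t5).  The companion file `CoveringGraphCoherent`
proves that {hypotheses of Prop. 3.6 ∧ COHERENT} is hereditary along connected tempered coverings of
arbitrary degree, in particular that `G_S` is Galois-countable
(`CovObj.isGaloisCountable_coveringGraph_of_isCoherent`).  This file shows that "coherent" cannot be
weakened to "quasi-coherent" there, by an explicit COUNTERMODEL (definitions of objects + their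
properties; no statement of the paper is retyped, no `Prop` fact is named):

* `bouquet` (`𝒢₀`): the loop (one vertex, one edge) with vertex group `P = ∏_ℕ ℤ/2` (product topology:
  compact, totally disconnected, second countable, NOT topologically finitely generated) and trivial edge
  group; it is connected, countable, has a vertex, is quasi-coherent (`bouquet_isQuasiCoherent`) and
  Galois-countable (`bouquet_isGaloisCountable`, family of level coverings `(ℤ/2)^i`), and is NOT coherent
  (`bouquet_not_isCoherent`, via the (T4) count `card_setOf_monoidHom_isOpen_ker_le`);
* `unwinding` (`S₀`): the `ℤ`-unwinding of the loop (fibres `ℤ`, trivial actions, gluings `n ↦ n` and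
  `n ↦ n + 1`) — tempered (`unwinding_isTempered`, split by the one-point covering) and connected
  (`isConnectedObj_unwinding`; its covering graph is the bi-infinite chain, `isConnected_coveringGraph_unwinding`);
* `not_isGaloisCountable_coveringGraph_unwinding` — **`G_{S₀}` is NOT Galois-countable**: against any
  countable family `F_i` of finite objects of `B^cov(G_{S₀})`, the diagonal degree-`2` covering `diagObj`
  (character `k ↦ k(m_i)` at the `i`-th vertex, `δ_{m_i}` chosen inside the open stabiliser of a point of
  `F_i` there) is split by no `F_i`;
* `exists_not_isGaloisCountable_coveringGraph`, `not_forall_isGaloisCountable_coveringGraph` — the record: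
  the heredity of (T2) along connected tempered coverings, with all of connected / countable / vertex /
  quasi-coherent / Galois-countable kept but coherence dropped, is FALSE.

Honest framing: a TIGHTNESS datum about the cell's typed heredity theorems (print's Prop. 3.6 (v) assumes
coherence; the finite-degree case needs no coherence).  `𝒢₀` is not a Prop-3.6 object (a trivial edge
group is never aloof as typed; the aloof/slim-grade variant replaces `ℤ/2` by a slim pro-`p` factor) — not
claimed.  Outside the [IUTchIII] Cor. 3.12 cone; nothing here bears on it.
-/

noncomputable section

open CategoryTheory Topology

namespace Literature.AnabelianGeometry.SemiGraphs

open Literature.AlgebraicGeometry.Frobenioids (IsConnectedObj)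
open Literature.AlgebraicGeometry.Frobenioids.QuasiTemperoid.BTempConnected (hom_ρ ρ_one_apply
  ρ_mul_apply ρ_inv_apply)

namespace ProfiniteSemiGraph

namespace IncoherentBouquet

/-! ### 4. The `ℤ`-unwinding `S₀` of the loop: a connected tempered covering of infinite degree -/

/-- **The `ℤ`-unwinding `S₀ ∈ B^cov(𝒢₀)`** ([SemiAnbd] §3 p. 36, Rmk. 3.5.1 p. 37: a graph-covering with
countable fibres): fibre `ℤ` with TRIVIAL actions over the vertex and over the edge; the branch `false`
glues by `n ↦ n`, the branch `true` by `n ↦ n + 1` — the universal covering of the loop, read as a locally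
trivial covering of `𝒢₀` of infinite degree. [cite: MochizukiSemiAnbd2006, Rmk 3.5.1 p.37] -/
def unwinding : CovObj bouquet where
  SV _ := trivialObj P ℤ
  SE _ := trivialObj PUnit ℤ
  glue b _ _ := match b with
    | false => BTemp.isoOfEquiv (Equiv.refl ℤ) fun _ _ => rfl
    | true => BTemp.isoOfEquiv (show ℤ ≃ ℤ from Equiv.addRight (1 : ℤ)) fun _ _ => rfl

/-- The gluing along the branch `false` is the identity. [cite: MochizukiSemiAnbd2006, Rmk 3.5.1 p.37] -/
@[simp] theorem unwinding_glue_false (h : loop.abuts false = some ()) (x : ℤ) :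
    (unwinding.glue false () h).hom.hom.hom x = x := rfl

/-- The gluing along the branch `true` is `n ↦ n + 1`. [cite: MochizukiSemiAnbd2006, Rmk 3.5.1 p.37] -/
@[simp] theorem unwinding_glue_true (h : loop.abuts true = some ()) (x : ℤ) :
    (unwinding.glue true () h).hom.hom.hom x = x + 1 := rfl

/-- The one-point covering of `𝒢₀` (the final object of `B^cov(𝒢₀)`). [cite: MochizukiSemiAnbd2006, §3 p.36] -/
def pointCov : CovObj bouquet where
  SV _ := trivialObj P PUnit
  SE _ := trivialObj PUnit PUnit
  glue _ _ _ := BTemp.isoOfEquiv (Equiv.refl _) fun _ _ => rfl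

/-- **`S₀` is tempered** ([SemiAnbd] Def. 3.5 (ii)): being locally trivial, it is split (at every point)
by the one-point covering. [cite: MochizukiSemiAnbd2006, Def 3.5(ii) p.37] -/
theorem unwinding_isTempered : unwinding.IsTempered := fun _ =>
  ⟨pointCov, ⟨fun _ => inferInstanceAs (Finite PUnit), fun _ => inferInstanceAs (Finite PUnit)⟩,
    ⟨fun _ => ⟨PUnit.unit⟩, fun _ => ⟨PUnit.unit⟩⟩, fun q _ => by
      rcases q with ⟨v, s⟩ | ⟨e, s⟩
      · intro _ _ _; rfl
      · intro _ _ _; rfl⟩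

/-! ### 5. The covering graph `G_{S₀}`: the bi-infinite chain, connected -/

/-- Orbits of a trivial action are points: the chosen representative of the class of `x` is `x`.
[cite: MochizukiSemiAnbd2006, Def 3.5(i) p.37] -/
theorem out_cl_trivialObj (K : Type) [Group K] [TopologicalSpace K] (X : Type) [Countable X] (x : X) :
    Quot.out (BTemp.cl (trivialObj K X) x) = x := by
  obtain ⟨g, hg⟩ := (BTemp.cl_eq_cl_iff (trivialObj K X) _ _).mp (Quot.out_eq (BTemp.cl (trivialObj K X) x))
  exact hg

/-- The vertex of `G_{S₀}` labelled by `n ∈ ℤ`. [cite: MochizukiSemiAnbd2006, Def 3.5(i) p.37] -/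
def vtx (n : ℤ) : unwinding.coveringGraph.graph.Vertex := ⟨(), BTemp.cl (trivialObj P ℤ) n⟩

/-- Every vertex of `G_{S₀}` is some `vtx n`. [cite: MochizukiSemiAnbd2006, Def 3.5(i) p.37] -/
theorem exists_vtx_eq (v' : unwinding.coveringGraph.graph.Vertex) : ∃ n : ℤ, vtx n = v' := by
  obtain ⟨⟨⟩, ω⟩ := v'
  obtain ⟨n, rfl⟩ := Quot.exists_rep ω
  exact ⟨n, rfl⟩

/-- The chosen base point of the vertex `vtx n` is `n`. [cite: MochizukiSemiAnbd2006, Def 3.5(i) p.37] -/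
theorem out_vtx (n : ℤ) : Quot.out (vtx n).2 = n := out_cl_trivialObj P ℤ n

/-- In `G_{S₀}`, the branch `(false, n)` abuts to `vtx n`. [cite: MochizukiSemiAnbd2006, Def 3.5(i) p.37] -/
theorem coveringGraph_abuts_false (n : ℤ) :
    unwinding.coveringGraph.graph.abuts ⟨false, BTemp.cl (trivialObj PUnit ℤ) n⟩ = some (vtx n) := rfl

/-- In `G_{S₀}`, the branch `(true, n)` abuts to `vtx (n + 1)`. [cite: MochizukiSemiAnbd2006, Def 3.5(i) p.37] -/
theorem coveringGraph_abuts_true (n : ℤ) :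
    unwinding.coveringGraph.graph.abuts ⟨true, BTemp.cl (trivialObj PUnit ℤ) n⟩ = some (vtx (n + 1)) := rfl

/-- One step of the chain: `vtx n` and `vtx (n + 1)` are joined in the subdivision of `G_{S₀}` (through
the branch `(false, n)`, the edge `n`, the branch `(true, n)`). [cite: MochizukiSemiAnbd2006, §1 p.11] -/
theorem reachable_vtx_succ (n : ℤ) :
    unwinding.coveringGraph.graph.subdivision.Reachable (Sum.inl (vtx n)) (Sum.inl (vtx (n + 1))) := by
  let G := unwinding.coveringGraph.graph
  let ω : BTemp.Orbits (trivialObj PUnit ℤ) := BTemp.cl (trivialObj PUnit ℤ) n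
  have h1 : G.subdivision.Adj (Sum.inr (Sum.inr ⟨false, ω⟩)) (Sum.inl (vtx n)) :=
    G.subdivision_adj_of_nodeRel (SemiGraph.NodeRel.branch_vertex (G := G) ⟨false, ω⟩ (vtx n)
      (coveringGraph_abuts_false n))
  have h2 : G.subdivision.Adj (Sum.inr (Sum.inl ⟨(), ω⟩)) (Sum.inr (Sum.inr ⟨false, ω⟩)) :=
    G.subdivision_adj_of_nodeRel (SemiGraph.NodeRel.edge_branch (G := G) ⟨false, ω⟩)
  have h3 : G.subdivision.Adj (Sum.inr (Sum.inl ⟨(), ω⟩)) (Sum.inr (Sum.inr ⟨true, ω⟩)) :=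
    G.subdivision_adj_of_nodeRel (SemiGraph.NodeRel.edge_branch (G := G) ⟨true, ω⟩)
  have h4 : G.subdivision.Adj (Sum.inr (Sum.inr ⟨true, ω⟩)) (Sum.inl (vtx (n + 1))) :=
    G.subdivision_adj_of_nodeRel (SemiGraph.NodeRel.branch_vertex (G := G) ⟨true, ω⟩ (vtx (n + 1))
      (coveringGraph_abuts_true n))
  exact ((h1.symm.reachable.trans h2.symm.reachable).trans h3.reachable).trans h4.reachable

/-- Every vertex of the chain is reachable from `vtx 0`. [cite: MochizukiSemiAnbd2006, §1 p.11] -/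
theorem reachable_vtx (n : ℤ) :
    unwinding.coveringGraph.graph.subdivision.Reachable (Sum.inl (vtx 0)) (Sum.inl (vtx n)) := by
  induction n using Int.induction_on with
  | zero => exact SimpleGraph.Reachable.refl _
  | succ k ih => exact ih.trans (reachable_vtx_succ k)
  | pred k ih =>
    have h := reachable_vtx_succ (-(k : ℤ) - 1)
    rw [show (-(k : ℤ) - 1 + 1) = -k by ring] at h
    exact ih.trans h.symm

/-- Every node of the subdivision of `G_{S₀}` is reachable from `vtx 0`. [cite: MochizukiSemiAnbd2006, §1 p.11] -/
theorem reachable_node (x : unwinding.coveringGraph.graph.Node) :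
    unwinding.coveringGraph.graph.subdivision.Reachable (Sum.inl (vtx 0)) x := by
  let G := unwinding.coveringGraph.graph
  have hbr : ∀ (b : Bool) (n : ℤ),
      G.subdivision.Reachable (Sum.inl (vtx 0)) (Sum.inr (Sum.inr ⟨b, BTemp.cl (trivialObj PUnit ℤ) n⟩)) := by
    intro b n
    cases b
    · exact (reachable_vtx _).trans
        (G.subdivision_adj_of_nodeRel (SemiGraph.NodeRel.branch_vertex (G := G) ⟨false, _⟩ _
          (coveringGraph_abuts_false n))).symm.reachable
    · exact (reachable_vtx _).trans
        (G.subdivision_adj_of_nodeRel (SemiGraph.NodeRel.branch_vertex (G := G) ⟨true, _⟩ _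
          (coveringGraph_abuts_true n))).symm.reachable
  rcases x with v' | ⟨⟨⟩, ω⟩ | ⟨b, ω⟩
  · obtain ⟨n, rfl⟩ := exists_vtx_eq v'
    exact reachable_vtx n
  · obtain ⟨n, rfl⟩ := Quot.exists_rep ω
    exact (hbr false n).trans
      (G.subdivision_adj_of_nodeRel (SemiGraph.NodeRel.edge_branch (G := G) ⟨false, _⟩)).symm.reachable
  · obtain ⟨n, rfl⟩ := Quot.exists_rep ω
    exact hbr b n

/-- **`G_{S₀}` is connected** (the bi-infinite chain). [cite: MochizukiSemiAnbd2006, §1 p.11] -/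
theorem isConnected_coveringGraph_unwinding : unwinding.coveringGraph.IsConnected := by
  haveI : Nonempty unwinding.coveringGraph.graph.Node := ⟨Sum.inl (vtx 0)⟩
  exact ⟨⟨fun x y => (reachable_node x).symm.trans (reachable_node y)⟩⟩

/-- `G_{S₀}` has a vertex. [cite: MochizukiSemiAnbd2006, Def 3.5(i) p.37] -/
theorem hasVertex_coveringGraph_unwinding : unwinding.coveringGraph.HasVertex := ⟨vtx 0⟩

/-- **`S₀` is a connected object of `B^temp(𝒢₀)`.** [cite: MochizukiSemiAnbd2006, Def 3.5(ii) p.37] -/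
theorem isConnectedObj_unwinding :
    IsConnectedObj (⟨unwinding, unwinding_isTempered⟩ : BTempCat bouquet) :=
  unwinding.isConnectedObj_of_isConnected_coveringGraph unwinding_isTempered
    isConnected_coveringGraph_unwinding hasVertex_coveringGraph_unwinding


/-! ### 6. The diagonal finite étale covering of `G_{S₀}` and the failure of (T2) -/

/-- The vertex groups of `G_{S₀}` are (the stabilisers, i.e.) all of `P`: every `k ∈ P` stabilises every
base point. [cite: MochizukiSemiAnbd2006, Def 3.5(i) p.37] -/
theorem mem_Gv (v' : unwinding.coveringGraph.graph.Vertex) (k : P) :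
    k ∈ BTemp.stab (unwinding.SV v'.1) (Quot.out v'.2) := rfl

/-- The branch homomorphisms of `G_{S₀}` are trivial (conjugates of the trivial gluing of `𝒢₀`).
[cite: MochizukiSemiAnbd2006, Def 3.5(i) p.37] -/
theorem coveringGraph_brHom_eq_one (b' : unwinding.coveringGraph.graph.Branch)
    (v' : unwinding.coveringGraph.graph.Vertex) (h' : unwinding.coveringGraph.graph.abuts b' = some v')
    (g : unwinding.coveringGraph.Ge (unwinding.coveringGraph.graph.edgeOf b')) :
    unwinding.coveringGraph.brHom b' v' h' g = 1 := by
  apply Subtype.ext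
  change unwinding.conjugator h' * (1 : PUnit →ₜ* P) g.1 * (unwinding.conjugator h')⁻¹ = 1
  change unwinding.conjugator h' * 1 * (unwinding.conjugator h')⁻¹ = 1
  rw [mul_one, mul_inv_cancel]

/-- The coordinate character `k ↦ k(m)` on a vertex group of `G_{S₀}`. [cite: MochizukiSemiAnbd2006, Def 3.5(i) p.37] -/
def coordChar (v' : unwinding.coveringGraph.graph.Vertex) (m : ℕ) : unwinding.coveringGraph.Gv v' →* M :=
  (Pi.evalMonoidHom (fun _ : ℕ => M) m).comp (Subgroup.subtype _)

/-- The coordinate characters are continuous. [cite: MochizukiSemiAnbd2006, Def 3.5(i) p.37] -/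
theorem continuous_coordChar (v' : unwinding.coveringGraph.graph.Vertex) (m : ℕ) :
    Continuous (coordChar v' m) :=
  (continuous_apply m).comp continuous_subtype_val

/-- **The diagonal covering.** For an assignment `m'` of a coordinate to every vertex of `G_{S₀}`, the
finite object `H_{m'}` of `B^cov(G_{S₀})` of degree `2`: over the vertex `v'` the set `ℤ/2` with
`Π_{v'} = P` acting through the character `k ↦ k(m' v')`, over the edges `ℤ/2` with trivial action,
identity gluings (legitimate because the branch homomorphisms of `G_{S₀}` are trivial).
[cite: MochizukiSemiAnbd2006, Def 3.5(i) p.37] -/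
def diagObj (m' : unwinding.coveringGraph.graph.Vertex → ℕ) : CovObj unwinding.coveringGraph where
  SV v' := charObj (coordChar v' (m' v')) (continuous_coordChar v' (m' v'))
  SE e' := trivialObj _ M
  glue b' v' h' := BTemp.isoOfEquiv (Equiv.refl M) fun g (x : M) => by
    change x = (charObj (coordChar v' (m' v')) (continuous_coordChar v' (m' v'))).obj.ρ
      (unwinding.coveringGraph.brHom b' v' h' g) x
    rw [charObj_ρ, coveringGraph_brHom_eq_one, map_one, one_mul]

/-- The diagonal covering is finite. [cite: MochizukiSemiAnbd2006, Def 3.5(i) p.37] -/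
theorem diagObj_isFinite (m' : unwinding.coveringGraph.graph.Vertex → ℕ) : (diagObj m').IsFinite :=
  ⟨fun _ => inferInstanceAs (Finite M), fun _ => inferInstanceAs (Finite M)⟩

/-- The action on the vertex fibres of the diagonal covering, in closed form.
[cite: MochizukiSemiAnbd2006, Def 3.5(i) p.37] -/
theorem diagObj_ρ (m' : unwinding.coveringGraph.graph.Vertex → ℕ)
    (v' : unwinding.coveringGraph.graph.Vertex) (k : P)
    (hk : k ∈ BTemp.stab (unwinding.SV v'.1) (Quot.out v'.2)) (x : M) :
    ((diagObj m').SV v').obj.ρ ⟨k, hk⟩ x = k (m' v') * x :=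
  charObj_ρ (coordChar v' (m' v')) (continuous_coordChar v' (m' v')) _ x

/-- **`G_{S₀}` is NOT Galois-countable** (failure of [IUTchI] Rmk. 2.5.3 (i) (T2) for the covering
semi-graph of anabelioids of the connected tempered covering `S₀` of the connected, countable,
quasi-coherent, Galois-countable — but incoherent — `𝒢₀`).  DIAGONAL ARGUMENT: given a countable family
`F_i` of finite objects of `B^cov(G_{S₀})` with nonempty fibres, pick at the vertex `vtx i` a point `z_i` of
`F_i`; its stabiliser is open in `P`, so contains some `δ_{m_i}`; the diagonal covering with coordinate
`m_i` at `vtx i` is then split by no `F_i`, since `δ_{m_i}` fixes `z_i` but acts as `-1` on the fibre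
`ℤ/2` over `vtx i`. [cite: Mochizuki2012, IUTchI Rmk 2.5.3 (i) (T2), p. 52] -/
theorem not_isGaloisCountable_coveringGraph_unwinding : ¬ unwinding.coveringGraph.IsGaloisCountable := by
  rintro ⟨-, F, hF, hsplit⟩
  -- at the vertex `vtx i`: a point of `F i` and a coordinate whose `δ` stabilises it
  have key : ∀ i : ℕ, ∃ (m : ℕ) (z : ((F i).SV (vtx i)).obj.V),
      ((F i).SV (vtx i)).obj.ρ ⟨δ m, mem_Gv (vtx i) (δ m)⟩ z = z := by
    intro i
    obtain ⟨z⟩ := (hF i).2.nonempty_V (vtx i)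
    have hopen : IsOpen {k : unwinding.coveringGraph.Gv (vtx i) | ((F i).SV (vtx i)).obj.ρ k z = z} :=
      ((F i).SV (vtx i)).property.2 z
    obtain ⟨U, hU, hUeq⟩ := isOpen_induced_iff.mp hopen
    have h1 : (1 : P) ∈ U := by
      have : (1 : unwinding.coveringGraph.Gv (vtx i)) ∈ Subtype.val ⁻¹' U := by
        rw [hUeq]
        exact ρ_one_apply _ z
      exact this
    obtain ⟨m, hm⟩ := exists_δ_mem_of_isOpen hU h1
    refine ⟨m, z, ?_⟩
    have : (⟨δ m, mem_Gv (vtx i) (δ m)⟩ : unwinding.coveringGraph.Gv (vtx i)) ∈ Subtype.val ⁻¹' U := hm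
    rw [hUeq] at this
    exact this
  choose m z hz using key
  -- the diagonal covering with coordinate `m i` at `vtx i`
  obtain ⟨i, hiV, -⟩ :=
    hsplit (diagObj fun v' => m (Quot.out v'.2).natAbs) (diagObj_isFinite _)
  have h := hiV (vtx i) (z i) ⟨δ (m i), mem_Gv (vtx i) (δ (m i))⟩ (hz i) (1 : M)
  rw [diagObj_ρ, mul_one, out_vtx, Int.natAbs_natCast] at h
  exact δ_apply_self_ne_one (m i) h

/-! ### 7. Record: coherence cannot be dropped in the heredity of the hypotheses of Prop 3.6 -/

/-- **The countermodel, packaged**: a connected, countable, quasi-coherent, Galois-countable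
semi-graph of anabelioids with a vertex (NOT coherent) and a connected tempered covering of it (of
infinite degree) whose covering semi-graph of anabelioids is not Galois-countable.
[cite: Mochizuki2012, IUTchI Rmk 2.5.3 (i) (T2), p. 52] -/
theorem exists_not_isGaloisCountable_coveringGraph :
    ∃ (𝒢 : ProfiniteSemiGraph.{0}) (S : CovObj 𝒢) (hS : S.IsTempered),
      𝒢.IsConnected ∧ 𝒢.IsCountable ∧ 𝒢.HasVertex ∧ 𝒢.IsQuasiCoherent ∧ 𝒢.IsGaloisCountable ∧
        ¬ 𝒢.IsCoherent ∧ IsConnectedObj (⟨S, hS⟩ : BTempCat 𝒢) ∧ ¬ S.coveringGraph.IsGaloisCountable :=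
  ⟨bouquet, unwinding, unwinding_isTempered, bouquet_isConnected, bouquet_isCountable, bouquet_hasVertex,
    bouquet_isQuasiCoherent, bouquet_isGaloisCountable, bouquet_not_isCoherent, isConnectedObj_unwinding,
    not_isGaloisCountable_coveringGraph_unwinding⟩

/-- **Galois-countability (T2) is NOT hereditary along connected tempered coverings of merely
quasi-coherent bases**: the universally quantified heredity statement with "coherent" weakened to
"quasi-coherent" (all of connected / countable / vertex / quasi-coherent / Galois-countable kept) is
FALSE — so the hypothesis `IsCoherent` of `CovObj.isGaloisCountable_coveringGraph_of_isCoherent`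
(`CoveringGraphCoherent`) cannot be dropped for coverings of infinite degree.
[cite: Mochizuki2012, IUTchI Rmk 2.5.3 (i) (T2), p. 52] -/
theorem not_forall_isGaloisCountable_coveringGraph :
    ¬ ∀ (𝒢 : ProfiniteSemiGraph.{0}) (S : CovObj 𝒢) (hS : S.IsTempered),
        𝒢.IsConnected → 𝒢.IsCountable → 𝒢.HasVertex → 𝒢.IsQuasiCoherent → 𝒢.IsGaloisCountable →
          IsConnectedObj (⟨S, hS⟩ : BTempCat 𝒢) → S.coveringGraph.IsGaloisCountable := fun h =>
  not_isGaloisCountable_coveringGraph_unwinding (h bouquet unwinding unwinding_isTempered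
    bouquet_isConnected bouquet_isCountable bouquet_hasVertex bouquet_isQuasiCoherent
    bouquet_isGaloisCountable isConnectedObj_unwinding)

end IncoherentBouquet

end ProfiniteSemiGraph

end Literature.AnabelianGeometry.SemiGraphs
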